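import Summits.FinalStateConjecture.FinalStateConjecture.Theses.ZeroEnergyKerrOrBomb
import Literature.Geometry.Lorentzian.ZeroEnergyRayTrappedModFlow

/-!
# Sketch — crux-ideate stmt-FinalStateConjecture-10691 (ErgoregionBomb), ideator 1, round 1

First-lemma signatures for the three crux idea cards
`krein-signed-tunnelling-duel`, `horizon-generator-at-the-collar`, `growth-is-modal`.
Everything here is a `def … : Prop` (statements only; nothing is claimed proved) except the
two small kernel-checked logic lemmas at the end.

READING OF THE CRUX USED HERE.  As typed, `ErgoregionBomb` is vacuously true (its trapping clause
`∀ s ≥ 0, γ s ∈ K`, `K` compact, contradicts `IsGloballyHyperbolic`; refuter evidence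
Evidence10691*.md / Cprime.lean on the item) and its `IsNonDegenerateHorizon` hands out a GLOBAL
horizon Killing field (sibling crux 10690: TRIAGE-r1-1 D-h3, Disproof (F3)).  The intended content
is `ErgoregionBombIntended` below: trapping MODULO THE STATIONARY FLOW and a horizon Killing field
on a COLLAR only.  `ErgoregionBombIntended → ErgoregionBomb` (`Transfer`) is pure logic plus
`subset_stationaryOrbit`, so every line below is a line for the served decl as well.
-/

noncomputable section

set_option linter.dupNamespace false

open Set Literature.Geometry.Lorentzian
open scoped Manifold ContDiff Topology Matrix

namespace Summit.FinalStateConjecture.FinalStateConjecture.Cruxes.ErgoregionBomb.Ideator1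

open Summit.FinalStateConjecture.FinalStateConjecture.Theses.ZeroEnergyKerrOrBomb (ErgoregionBomb)

universe u

/-! ## The intended crux C″ (collar horizon Killing field, trapping mod flow) -/

section Intended

variable (𝓑 : StationaryAFBlackHole.{0}) [𝓑.metric.HasLeviCivita]

/-- Collar form of non-degeneracy (the typing of route `BeltLiouville.SmoothHawkingRigidity`): a
vector field `K`, smooth and Killing on an open `U ⊇ 𝓗⁺` only, nowhere zero on and tangent to `𝓗⁺`,
with `∇_K K = κ K` there, `κ ≠ 0`.  This is what smooth local Hawking rigidity gives
(Alexakis–Ionescu–Klainerman 2010, Thms 1.1–1.2), as opposed to the GLOBAL Killing field of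
`IsNonDegenerateHorizon`. -/
def CollarNonDegenerate : Prop :=
  ∃ (U : Set 𝓑.carrier) (K : Π x : 𝓑.carrier, TangentSpace (𝓡 4) x) (κ : ℝ),
    IsOpen U ∧ 𝓑.horizon ⊆ U ∧
    ContMDiffOn (𝓡 4) ((𝓡 4).prod 𝓘(ℝ, E4)) ∞
      (fun x ↦ (Bundle.TotalSpace.mk' E4 x (K x) : TangentBundle (𝓡 4) 𝓑.carrier)) U ∧
    (∀ x ∈ U, ∀ v w : TangentSpace (𝓡 4) x,
      𝓑.metric.val x (𝓑.metric.leviCivita K x v) w + 𝓑.metric.val x v (𝓑.metric.leviCivita K x w) = 0) ∧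
    (∀ p ∈ 𝓑.horizon, K p ≠ 0) ∧
    (∀ γ : ℝ → 𝓑.carrier, IsMIntegralCurve γ K → γ 0 ∈ 𝓑.horizon → ∀ t, γ t ∈ 𝓑.horizon) ∧
    κ ≠ 0 ∧ ∀ p ∈ 𝓑.horizon, 𝓑.metric.leviCivita K p (K p) = κ • K p

/-- The growing Killing-mode conclusion of the crux, verbatim (ν > 0; frequency `ϖ`, `ϖ = 0` allowed; `ω` is notation under `open scoped ContDiff`). -/
def HasGrowingKillingModePair : Prop :=
  ∃ (ν ϖ : ℝ) (ψ χ : 𝓑.carrier → ℝ), 0 < ν ∧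
    (∃ U : Set 𝓑.carrier, IsOpen U ∧ 𝓑.doc ∪ 𝓑.horizon ⊆ U ∧
      ContMDiffOn (𝓡 4) 𝓘(ℝ, ℝ) ((⊤ : ℕ∞) : WithTop ℕ∞) ψ U ∧
      ContMDiffOn (𝓡 4) 𝓘(ℝ, ℝ) ((⊤ : ℕ∞) : WithTop ℕ∞) χ U) ∧
    (∀ x ∈ 𝓑.doc, 𝓑.metric.dalembertian ψ x = 0 ∧ 𝓑.metric.dalembertian χ x = 0) ∧
    (∀ x ∈ 𝓑.doc, mfderiv (𝓡 4) 𝓘(ℝ, ℝ) ψ x (𝓑.killing x) = ν * ψ x - ϖ * χ x ∧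
      mfderiv (𝓡 4) 𝓘(ℝ, ℝ) χ x (𝓑.killing x) = ϖ * ψ x + ν * χ x) ∧
    (∃ C : ℝ, ∀ x ∈ 𝓑.doc ∩ 𝓑.metric.chronologicalPast 𝓑.timeOrientation
        (𝓑.embed '' 𝓑.e.far (𝓑.e.R + 1)), |ψ x| ≤ C ∧ |χ x| ≤ C) ∧
    ∃ x ∈ 𝓑.doc, ψ x ≠ 0 ∨ χ x ≠ 0

/-- A future zero-energy null geodesic ray trapped MODULO THE STATIONARY FLOW (refuters' C′:
`γ s ∈ stationaryOrbit T K`, `K` compact ⊆ doc). -/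
def HasRayTrappedModFlow : Prop :=
  ∃ (γ : ℝ → 𝓑.carrier) (K : Set 𝓑.carrier),
    IsGeodesicOn 𝓑.metric.leviCivita γ (Set.Ici 0) ∧
    (∀ s : ℝ, 0 ≤ s → 𝓑.metric.IsNull (velocity (𝓡 4) γ s) ∧
      𝓑.metric.val (γ s) (𝓑.killing (γ s)) (velocity (𝓡 4) γ s) = 0) ∧
    IsCompact K ∧ K ⊆ 𝓑.doc ∧ ∀ s : ℝ, 0 ≤ s → γ s ∈ stationaryOrbit 𝓑.killing K

end Intended

/-- **C″ — the intended ErgoregionBomb.**  Vacuum, connected horizon, COLLAR non-degeneracy,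
globally hyperbolic, `T ≠ 0` on doc, a zero-energy ray trapped mod flow ⟹ a growing Killing-mode
pair.  (Stronger than the served decl: weaker `h3`, weaker trapping hypothesis.) -/
def ErgoregionBombIntended : Prop :=
  ∀ (𝓑 : StationaryAFBlackHole.{0}) [𝓑.metric.HasLeviCivita] [Kerr.Facts],
    𝓑.metric.toPseudoRiemannianMetric.IsRicciFlat → IsConnected 𝓑.horizon →
    CollarNonDegenerate 𝓑 → 𝓑.metric.IsGloballyHyperbolic 𝓑.timeOrientation →
    (∀ p ∈ 𝓑.doc, 𝓑.killing p ≠ 0) → HasRayTrappedModFlow 𝓑 → HasGrowingKillingModePair 𝓑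

/-- **Transfer** (stub of every line): C″ implies the served decl — a global horizon Killing field
restricts to the collar `U = univ` (its smoothness being part of `IsKillingField`), and a ray inside a
compact `K` is inside `stationaryOrbit T K ⊇ K` (`subset_stationaryOrbit`, `T` complete). -/
def Transfer : Prop := ErgoregionBombIntended → ErgoregionBomb

/-! ## Card `horizon-generator-at-the-collar` — first lemma (regime R0) -/

/-- **R0: a non-rotating smooth stationary vacuum hole has no ergoregion.**  If the stationary
field `T` is null along the (connected, collar-non-degenerate) horizon — i.e. tangent to its
generators — then `T` is timelike on the whole d.o.c.  Route: Rácz–Wald bifurcate extension +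
Chruściel–Wald maximal slice + Sudarsky–Wald staticity ⟹ static ⟹ (Chruściel–Galloway 2010 /
static uniqueness, tree `ChruscielGalloway2010_staticUniqueness`) Schwarzschild exterior, or directly
the Vishveshwara–Carter lemma for static d.o.c.s.  Consequence (with
`killing_sq_nonneg_of_zeroEnergyNull`): no zero-energy null vector exists on the d.o.c., so C″ holds
vacuously in regime R0. -/
def NonRotatingNoErgoregion : Prop :=
  ∀ (𝓑 : StationaryAFBlackHole.{0}) [𝓑.metric.HasLeviCivita],
    𝓑.metric.toPseudoRiemannianMetric.IsRicciFlat → IsConnected 𝓑.horizon →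
    CollarNonDegenerate 𝓑 → 𝓑.metric.IsGloballyHyperbolic 𝓑.timeOrientation →
    (∀ p ∈ 𝓑.horizon, 𝓑.metric.val p (𝓑.killing p) (𝓑.killing p) = 0) →
    ∀ p ∈ 𝓑.doc, 𝓑.metric.IsTimelike (𝓑.killing p)

/-- R0 corollary, the form the line consumes: non-rotating ⟹ no zero-energy ray at all. -/
def NonRotatingNoZeroEnergyRay : Prop :=
  ∀ (𝓑 : StationaryAFBlackHole.{0}) [𝓑.metric.HasLeviCivita],
    𝓑.metric.toPseudoRiemannianMetric.IsRicciFlat → IsConnected 𝓑.horizon →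
    CollarNonDegenerate 𝓑 → 𝓑.metric.IsGloballyHyperbolic 𝓑.timeOrientation →
    (∀ p ∈ 𝓑.horizon, 𝓑.metric.val p (𝓑.killing p) (𝓑.killing p) = 0) →
    ¬ HasRayTrappedModFlow 𝓑

/-- **R1 kinematics (collar counter-rotation), pointwise algebra.**  At a collar point where the
horizon Killing field `K = T + Ω • Y` is future-directed timelike, every future-directed null vector
`v` of zero `T`-energy has `Ω · g(v, Y) = g(v, K) < 0`: zero-energy rays entering the `K`-causal
collar counter-rotate strictly.  (Reverse Cauchy–Schwarz; this fixes the Krein signature of the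
horizon channels classically fed by a zero-energy island.) -/
def CollarCounterRotation : Prop :=
  ∀ (𝓑 : StationaryAFBlackHole.{0}) (x : 𝓑.carrier) (K Y v : TangentSpace (𝓡 4) x) (Ω : ℝ),
    K = 𝓑.killing x + Ω • Y → 𝓑.timeOrientation.IsFutureDirected K → 𝓑.metric.IsTimelike K →
    𝓑.timeOrientation.IsFutureDirected v → 𝓑.metric.val x v v = 0 →
    𝓑.metric.val x v (𝓑.killing x) = 0 → Ω * 𝓑.metric.val x v Y < 0

/-! ## Card `krein-signed-tunnelling-duel` — first lemma (finite-dimensional rung) -/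

/-- **Kelvin–Tait–Chetaev (complete dissipation destroys gyroscopic stabilisation).**  For the
linear mechanical system `q̈ + (D + G) q̇ + K q = 0` with damping `D ≻ 0`, gyroscopic `Gᵀ = −G` and a
non-singular symmetric stiffness `K` possessing a negative direction, there is an exponentially
growing solution: the quadratic pencil `μ² + μ (D + G) + K` is singular at some `μ` with `Re μ > 0`
(Chetaev 1961; Zajac 1964; Krechetnikov–Marsden, Rev. Mod. Phys. 79 (2007) §III).  This is the
rung-0 shadow of the line's mechanism with ALL channels dissipative (non-rotating horizon / belt
case); the rotating case replaces `D ≻ 0` by a signed channel sum, which is the content of the card. -/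
def KelvinTaitChetaev : Prop :=
  ∀ (n : ℕ) (D G K : Matrix (Fin n) (Fin n) ℝ), D.PosDef → G.transpose = -G → K.IsSymm →
    K.det ≠ 0 → (∃ v : Fin n → ℝ, dotProduct v (K.mulVec v) < 0) →
    ∃ μ : ℂ, 0 < μ.re ∧
      (μ ^ 2 • (1 : Matrix (Fin n) (Fin n) ℂ) + μ • (D + G).map (algebraMap ℝ ℂ) +
        K.map (algebraMap ℝ ℂ)).det = 0

/-- **Signed version (MacKay 1991 / Krein): the dissipation FELT by a negative-energy mode decides.**
Same system with `D` merely symmetric (indefinite: superradiant channels are anti-damping for the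
`T`-energy).  If the undamped gyroscopic system `q̈ + G q̇ + K q = 0` has a simple non-zero purely
imaginary eigenvalue `i ω₀` with eigenvector `z` of NEGATIVE energy
`E(z) = ω₀² ‖z‖² + z* K z < 0`, and the damping power on it is positive, `Re (z* D z) > 0`, then for
all small `ε > 0` the pencil `μ² + μ (ε D + G) + K` has a root with `Re μ > 0` near `i ω₀`.
(Statement of the first-order formula `Re μ'(0) = −(z* D z) ω₀² / (dE-normalisation)`; the card's
infinite-dimensional analogue is the Grushin-reduced flux identity.) -/
def SignedKelvinTaitChetaev : Prop :=
  ∀ (n : ℕ) (D G K : Matrix (Fin n) (Fin n) ℝ) (ω₀ : ℝ) (z : Fin n → ℂ), D.IsSymm →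
    G.transpose = -G → K.IsSymm → ω₀ ≠ 0 → z ≠ 0 →
    -- `i ω₀` is a simple root of the undamped pencil with null vector `z`
    ((((Complex.I * ω₀) ^ 2) • (1 : Matrix (Fin n) (Fin n) ℂ) +
        (Complex.I * ω₀) • G.map (algebraMap ℝ ℂ) + K.map (algebraMap ℝ ℂ)).mulVec z = 0) →
    (∀ w : Fin n → ℂ, (((Complex.I * ω₀) ^ 2) • (1 : Matrix (Fin n) (Fin n) ℂ) +
        (Complex.I * ω₀) • G.map (algebraMap ℝ ℂ) + K.map (algebraMap ℝ ℂ)).mulVec w = 0 →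
        ∃ c : ℂ, w = c • z) →
    -- negative energy and positive felt damping
    (ω₀ ^ 2 * (dotProduct (star z) z).re + (dotProduct (star z) ((K.map (algebraMap ℝ ℂ)).mulVec z)).re < 0) →
    0 < (dotProduct (star z) ((D.map (algebraMap ℝ ℂ)).mulVec z)).re →
    ∃ ε₀ : ℝ, 0 < ε₀ ∧ ∀ ε : ℝ, 0 < ε → ε < ε₀ →
      ∃ μ : ℂ, 0 < μ.re ∧
        (μ ^ 2 • (1 : Matrix (Fin n) (Fin n) ℂ) + μ • (ε • D + G).map (algebraMap ℝ ℂ) +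
          K.map (algebraMap ℝ ℂ)).det = 0

/-! ## Card `growth-is-modal` — first lemma (bounded-generator rung) -/

/-- **Exponential growth is spectral (bounded rung of Gearhart–Prüss).**  If the group generated by
a bounded operator `A` on a complex Hilbert space grows at rate `ν > 0` on some vector, then `A` has
spectrum in `{Re ≥ ν}` (spectral radius formula + spectral mapping for `exp`).  The card needs the
`C₀`-semigroup version (Gearhart–Prüss) for the wave group on a stationary black-hole exterior,
together with meromorphy of the stationary resolvent on `{Im ω > 0}`, to turn "some finite-energy
solution grows exponentially" into a growing Killing MODE (answering the footnote objection that an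
instability need not be modal). -/
def ExpGrowthIsSpectral : Prop :=
  ∀ (H : Type) [NormedAddCommGroup H] [InnerProductSpace ℂ H] [CompleteSpace H]
    (A : H →L[ℂ] H) (x : H) (ν c : ℝ), 0 < ν → 0 < c →
    (∀ t : ℝ, 0 ≤ t → c * Real.exp (ν * t) ≤ ‖NormedSpace.exp ((t : ℂ) • A) x‖) →
    ∃ μ ∈ spectrum ℂ A, ν ≤ μ.re

/-! ## Two checked logic lemmas -/

/-- R0 makes C″ vacuous-true on non-rotating holes (pure logic). -/
theorem intended_of_nonRotating (h0 : NonRotatingNoZeroEnergyRay)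
    (𝓑 : StationaryAFBlackHole.{0}) [𝓑.metric.HasLeviCivita] [Kerr.Facts]
    (h1 : 𝓑.metric.toPseudoRiemannianMetric.IsRicciFlat) (h2 : IsConnected 𝓑.horizon)
    (h3 : CollarNonDegenerate 𝓑) (h4 : 𝓑.metric.IsGloballyHyperbolic 𝓑.timeOrientation)
    (hnr : ∀ p ∈ 𝓑.horizon, 𝓑.metric.val p (𝓑.killing p) (𝓑.killing p) = 0)
    (htrap : HasRayTrappedModFlow 𝓑) : HasGrowingKillingModePair 𝓑 :=
  absurd htrap (h0 𝓑 h1 h2 h3 h4 hnr)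

/-- The zero-energy null velocity of a trapped ray forces the closed ergoregion to be non-empty
(tree lemma `killing_sq_nonneg_of_zeroEnergyNull`), recorded in the ray form used here. -/
theorem ergoregion_nonempty_of_ray (𝓑 : StationaryAFBlackHole.{0}) [𝓑.metric.HasLeviCivita]
    (h : HasRayTrappedModFlow 𝓑) :
    ∃ x : 𝓑.carrier, 0 ≤ 𝓑.metric.val x (𝓑.killing x) (𝓑.killing x) := by
  obtain ⟨γ, K, -, hnull, -, -, -⟩ := h
  obtain ⟨⟨hv, hv0⟩, hT⟩ := hnull 0 le_rfl
  exact ⟨γ 0, 𝓑.killing_sq_nonneg_of_zeroEnergyNull hv hv0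
    ((𝓑.metric.symm (γ 0) _ _).trans hT)⟩

end Summit.FinalStateConjecture.FinalStateConjecture.Cruxes.ErgoregionBomb.Ideator1
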